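import Summits.NavierStokesRegularity.FluidComputer.PalasekTowerGermHostExplicitAt
import Literature.Analysis.FluidPDE.IsometryInvariance
import Literature.Analysis.FluidPDE.AxisymmetricReflection

/-!
# The germ host under linear isometries: the germ schedule of an AXISYMMETRIC SWIRL-FREE profile has an
# axisymmetric swirl-free force (covariance of the Newtonian potential, the acceleration and the germ)

Cell `ns-blowup`, seat `ns-blowup-ecbridge-3` (g12; D-0074 GROUP C «BRIDGE SUPPORT», lineage `host_preparation`).
Route `PalasekTowerBreakdown` (rev 19); crux stmt-NavierStokesRegularity-20303 `EpisodeBaseT` and the heredity pair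
20304/20305. LABEL: E–C typing (KERNEL: theorems only; no definition, no named fact). WHAT THIS IS NOT: not
Navier–Stokes evidence — pointwise identities for the germ host's PRESCRIBED fields under a linear isometry of
`ℝ³`; no flow, stage or design is constructed and nothing is asserted about any free run.

## The point

The companion-free germ line (`Germ.LevelZeroDataAt.episodeBaseGAt_of_sliceRun` / `…_of_freeRun`, p530054; the
explicit slot `LineGermDataAt`) registers the GERM SCHEDULE of the strict-slot profile `U` itself: datum `0`, force
`germForce 1 U αhost (βhost σ₀) T w` = the faded Navier–Stokes residual of the line germ `α(t)•(U + β(t)•V)`,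
`V = accel 1 U = P(ΔU − (U·∇)U)`. The refuters' decider K201 (`HeredityFromTwoTFalseOfNoSwirlRungT`) consumes a
registered design whose datum AND force are axisymmetric swirl-free (`NoSwirlDesign`). This file proves the missing
link: every object of the germ host is COVARIANT under a linear isometry `A` of `ℝ³` — if `U` is replaced by its
conjugate `A ∘ U ∘ A⁻¹` then the drift, the pressure potential (`Germ.pot = divPotential ∘ drift`, a Newtonian
potential: change of variables under the measure-preserving `A` and radiality of `newtonKernel` —
`divPotential_conj_linearIsometryEquiv`, the one lemma not already in Literature `IsometryInvariance`), the
acceleration, the germ, its pressure, its residual and the faded force are replaced by their conjugates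
(`germForce_conj_linearIsometryEquiv`). Hence a profile FIXED by conjugation with `A` has a germ force fixed by it
(`germForce_conj_eq_self`), and with `A` ranging over the rotations `rotZLIE θ` and the meridian reflection `reflY`
(tree characterisations `isAxisymmetric_iff_conj_rotZLIE`, `IsAxisymmetric.conj_reflY_eq`,
`IsAxisymmetric.hasNoSwirl_of_conj_reflY_eq`): **`U` axisymmetric swirl-free ⇒ `germForce 1 U α β T w t` and
`lineForce U σ₀ ε t` axisymmetric swirl-free at every `t`** (`isAxisymmetric_germForce`, `hasNoSwirl_germForce`,
`isAxisymmetric_lineForce`, `hasNoSwirl_lineForce`), and so are the force slices of the two germ schedules at any rates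
`R` (`LevelZeroDataAt.schedule`, `LineGermDataAt.schedule`; their datum is `0`). The Theorems-side corollary (same
seat) turns a sterile strict-slot free run into `NoSwirlRungGAt R 1`, on which K201 fires.

References: A. J. Majda, A. L. Bertozzi, *Vorticity and Incompressible Flow* (CUP 2002), §1.2 Prop. 1.1 and §1.8
Prop. 1.16 [cite: MajdaBertozziCUP2002, §1.2 Prop. 1.1]; D. Gilbarg, N. S. Trudinger (2001), §2.4
[cite: GilbargTrudinger2001, Lemma 4.1]; S. Palasek, arXiv:2605.13827 §3.3 [cite: Palasek2026ElementaryModel, §3.3].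
-/

noncomputable section

namespace Summit.NavierStokesRegularity.FluidComputer.PalasekTowerClayBridge.Germ

open Set Function MeasureTheory InnerProductSpace
open scoped ContDiff RealInnerProductSpace Laplacian
open Literature.Analysis Literature.Analysis.FluidPDE

section Conj

variable (A : EuclideanSpace ℝ (Fin 3) ≃ₗᵢ[ℝ] EuclideanSpace ℝ (Fin 3))

/-! ## §1 The Newtonian potential and the Leray projection under a linear isometry -/

/-- The Newton kernel is radial: `Γ(A z) = Γ(z)`. [cite: GilbargTrudinger2001, Lemma 4.1] -/
theorem newtonKernel_linearIsometryEquiv (z : EuclideanSpace ℝ (Fin 3)) : newtonKernel (A z) = newtonKernel z := by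
  unfold newtonKernel
  rw [A.norm_map]

/-- **The Newtonian potential of the divergence is isometry covariant**: `π[A G A⁻¹](x) = π[G](A⁻¹ x)`
(`div (A G A⁻¹) = (div G) ∘ A⁻¹`, the substitution `t = A s` is measure preserving, `Γ` is radial). Unconditional.
[cite: MajdaBertozziCUP2002, §1.8 Prop. 1.16] -/
theorem divPotential_conj_linearIsometryEquiv (G : EuclideanSpace ℝ (Fin 3) → EuclideanSpace ℝ (Fin 3))
    (x : EuclideanSpace ℝ (Fin 3)) :
    divPotential (fun y => A (G (A.symm y))) x = divPotential G (A.symm x) := by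
  rw [divPotential_apply, divPotential_apply]
  simp_rw [divergence_conj_linearIsometryEquiv]
  have h := A.measurePreserving.integral_comp A.toHomeomorph.measurableEmbedding
    (fun t => newtonKernel (x - t) * VectorCalculus.divergence G (A.symm t))
  rw [← h]
  refine integral_congr_ae (Filter.Eventually.of_forall fun s => ?_)
  dsimp only
  rw [A.symm_apply_apply, show x - A s = A (A.symm x - s) by rw [map_sub, A.apply_symm_apply],
    newtonKernel_linearIsometryEquiv]

/-- Function form of `divPotential_conj_linearIsometryEquiv`. [folklore] -/
theorem divPotential_conj_eq (G : EuclideanSpace ℝ (Fin 3) → EuclideanSpace ℝ (Fin 3)) :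
    divPotential (fun y => A (G (A.symm y))) = fun x => divPotential G (A.symm x) :=
  funext (divPotential_conj_linearIsometryEquiv A G)

/-- **The classical Leray projection is isometry covariant**: `P[A G A⁻¹](x) = A (P[G](A⁻¹ x))`.
[cite: MajdaBertozziCUP2002, §1.8 Prop. 1.16] -/
theorem classicalLerayProj_conj_linearIsometryEquiv (G : EuclideanSpace ℝ (Fin 3) → EuclideanSpace ℝ (Fin 3))
    (x : EuclideanSpace ℝ (Fin 3)) :
    classicalLerayProj (fun y => A (G (A.symm y))) x = A (classicalLerayProj G (A.symm x)) := by
  rw [classicalLerayProj_apply, classicalLerayProj_apply, divPotential_conj_eq,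
    gradient_comp_linearIsometryEquiv_symm, map_sub]

/-! ## §2 Drift, pressure potential and acceleration of a conjugated profile -/

variable (ν : ℝ) (U : EuclideanSpace ℝ (Fin 3) → EuclideanSpace ℝ (Fin 3))

/-- `drift ν (A U A⁻¹) (x) = A (drift ν U (A⁻¹ x))`. [cite: MajdaBertozziCUP2002, §1.2 Prop. 1.1] -/
theorem drift_conj_linearIsometryEquiv (x : EuclideanSpace ℝ (Fin 3)) :
    drift ν (fun y => A (U (A.symm y))) x = A (drift ν U (A.symm x)) := by
  unfold drift
  rw [laplacian_conj_linearIsometryEquiv, convect_conj_linearIsometryEquiv, map_sub, map_smul]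

/-- Function form of `drift_conj_linearIsometryEquiv`. [folklore] -/
theorem drift_conj_eq : drift ν (fun y => A (U (A.symm y))) = fun x => A (drift ν U (A.symm x)) :=
  funext (drift_conj_linearIsometryEquiv A ν U)

/-- `pot ν (A U A⁻¹) (x) = pot ν U (A⁻¹ x)`. [cite: MajdaBertozziCUP2002, §1.8 Prop. 1.16] -/
theorem pot_conj_linearIsometryEquiv (x : EuclideanSpace ℝ (Fin 3)) :
    pot ν (fun y => A (U (A.symm y))) x = pot ν U (A.symm x) := by
  unfold pot
  rw [drift_conj_eq, divPotential_conj_linearIsometryEquiv]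

/-- Function form of `pot_conj_linearIsometryEquiv`. [folklore] -/
theorem pot_conj_eq : pot ν (fun y => A (U (A.symm y))) = fun x => pot ν U (A.symm x) :=
  funext (pot_conj_linearIsometryEquiv A ν U)

/-- `accel ν (A U A⁻¹) (x) = A (accel ν U (A⁻¹ x))`. [cite: MajdaBertozziCUP2002, §1.8 Prop. 1.16] -/
theorem accel_conj_linearIsometryEquiv (x : EuclideanSpace ℝ (Fin 3)) :
    accel ν (fun y => A (U (A.symm y))) x = A (accel ν U (A.symm x)) := by
  unfold accel
  rw [drift_conj_eq, classicalLerayProj_conj_linearIsometryEquiv]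

/-! ## §3 The germ, its pressure, its residual and the faded force of a conjugated profile -/

variable (α β : ℝ → ℝ)

/-- `germ ν (A U A⁻¹) α β t x = A (germ ν U α β t (A⁻¹ x))`. [folklore] -/
theorem germ_conj_linearIsometryEquiv (t : ℝ) (x : EuclideanSpace ℝ (Fin 3)) :
    germ ν (fun y => A (U (A.symm y))) α β t x = A (germ ν U α β t (A.symm x)) := by
  unfold germ
  rw [accel_conj_linearIsometryEquiv, map_add, map_smul, map_smul]

/-- Function form of `germ_conj_linearIsometryEquiv` (slice at time `t`). [folklore] -/
theorem germ_conj_eq (t : ℝ) :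
    germ ν (fun y => A (U (A.symm y))) α β t = fun x => A (germ ν U α β t (A.symm x)) :=
  funext (germ_conj_linearIsometryEquiv A ν U α β t)

/-- `germPres ν (A U A⁻¹) β t x = germPres ν U β t (A⁻¹ x)` (`‖A w‖ = ‖w‖`). [folklore] -/
theorem germPres_conj_linearIsometryEquiv (t : ℝ) (x : EuclideanSpace ℝ (Fin 3)) :
    germPres ν (fun y => A (U (A.symm y))) β t x = germPres ν U β t (A.symm x) := by
  unfold germPres
  rw [pot_conj_eq, gradient_comp_linearIsometryEquiv_symm, A.norm_map]

/-- Function form of `germPres_conj_linearIsometryEquiv` (slice at time `t`). [folklore] -/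
theorem germPres_conj_eq (t : ℝ) :
    germPres ν (fun y => A (U (A.symm y))) β t = fun x => germPres ν U β t (A.symm x) :=
  funext (germPres_conj_linearIsometryEquiv A ν U β t)

/-- **The germ's residual is isometry covariant**: `germResid ν (A U A⁻¹) α β t x = A (germResid ν U α β t (A⁻¹ x))`.
[cite: MajdaBertozziCUP2002, §1.2 Prop. 1.1] -/
theorem germResid_conj_linearIsometryEquiv (t : ℝ) (x : EuclideanSpace ℝ (Fin 3)) :
    germResid ν (fun y => A (U (A.symm y))) α β t x = A (germResid ν U α β t (A.symm x)) := by
  unfold germResid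
  rw [germ_conj_eq, germPres_conj_eq, accel_conj_linearIsometryEquiv, convect_conj_linearIsometryEquiv,
    laplacian_conj_linearIsometryEquiv, gradient_comp_linearIsometryEquiv_symm]
  simp only [map_add, map_sub, map_smul]

/-- **The faded germ force is isometry covariant**:
`germForce ν (A U A⁻¹) α β T w t x = A (germForce ν U α β T w t (A⁻¹ x))`. [cite: Palasek2026ElementaryModel, §3.3] -/
theorem germForce_conj_linearIsometryEquiv (T w t : ℝ) (x : EuclideanSpace ℝ (Fin 3)) :
    germForce ν (fun y => A (U (A.symm y))) α β T w t x = A (germForce ν U α β T w t (A.symm x)) := by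
  unfold germForce
  rw [germResid_conj_linearIsometryEquiv, map_smul]

variable {A U}

/-- A profile FIXED by conjugation with `A` has a germ force fixed by it. [folklore] -/
theorem germForce_conj_eq_self (hU : ∀ x, A (U (A.symm x)) = U x) (T w t : ℝ) (x : EuclideanSpace ℝ (Fin 3)) :
    A (germForce ν U α β T w t (A.symm x)) = germForce ν U α β T w t x := by
  have hU' : (fun y => A (U (A.symm y))) = U := funext hU
  rw [← germForce_conj_linearIsometryEquiv, hU']

end Conj

/-! ## §4 Axisymmetric swirl-free profiles have axisymmetric swirl-free germ forces -/

section Axisym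

variable {ν : ℝ} {U : EuclideanSpace ℝ (Fin 3) → EuclideanSpace ℝ (Fin 3)} {α β : ℝ → ℝ}

/-- **An axisymmetric profile has an axisymmetric germ force** (conjugation by every `rotZLIE θ`).
[cite: MajdaBertozziCUP2002, §2.3.3 (2.52)–(2.53)] -/
theorem isAxisymmetric_germForce (hU : IsAxisymmetric U) (T w t : ℝ) :
    IsAxisymmetric (germForce ν U α β T w t) := by
  rw [isAxisymmetric_iff_conj_rotZLIE]
  intro θ x
  exact germForce_conj_eq_self ν α β ((isAxisymmetric_iff_conj_rotZLIE U).1 hU θ) T w t x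

/-- **An axisymmetric swirl-free profile has a swirl-free germ force** (conjugation by the meridian reflection
`reflY`). [cite: MajdaBertozziCUP2002, §2.3.3 (2.52)–(2.53)] -/
theorem hasNoSwirl_germForce (hU : IsAxisymmetric U) (hsw : HasNoSwirl U) (T w t : ℝ) :
    HasNoSwirl (germForce ν U α β T w t) :=
  (isAxisymmetric_germForce hU T w t).hasNoSwirl_of_conj_reflY_eq
    (germForce_conj_eq_self ν α β (hU.conj_reflY_eq hsw) T w t)

/-- The line force of an axisymmetric profile is axisymmetric. [folklore] -/
theorem isAxisymmetric_lineForce (hU : IsAxisymmetric U) (σ₀ ε t : ℝ) : IsAxisymmetric (lineForce U σ₀ ε t) :=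
  isAxisymmetric_germForce hU _ _ t

/-- The line force of an axisymmetric swirl-free profile is swirl-free. [folklore] -/
theorem hasNoSwirl_lineForce (hU : IsAxisymmetric U) (hsw : HasNoSwirl U) (σ₀ ε t : ℝ) :
    HasNoSwirl (lineForce U σ₀ ε t) :=
  hasNoSwirl_germForce hU hsw _ _ t

/-- The zero field is axisymmetric. [folklore] -/
theorem isAxisymmetric_zero_field : IsAxisymmetric (0 : EuclideanSpace ℝ (Fin 3) → EuclideanSpace ℝ (Fin 3)) := by
  intro θ x
  ext i
  fin_cases i <;> simp

/-- The zero field has no swirl. [folklore] -/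
theorem hasNoSwirl_zero_field : HasNoSwirl (0 : EuclideanSpace ℝ (Fin 3) → EuclideanSpace ℝ (Fin 3)) := by
  intro x
  simp [swirl]

end Axisym

/-! ## §5 The two germ schedules at the rates `R` of an axisymmetric swirl-free profile -/

namespace LevelZeroDataAt

variable {R : TowerRates} {U : EuclideanSpace ℝ (Fin 3) → EuclideanSpace ℝ (Fin 3)} {ρ : ℝ}
  (h : LevelZeroDataAt R U ρ)
include h

/-- **The germ schedule of an axisymmetric swirl-free strict-slot profile is an axisymmetric swirl-free DESIGN**:
its datum is `0` and its force `h.force hc₄ = germForce 1 U αhost (βhost σ₀) (1 + ε) ε` is axisymmetric swirl-free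
at every time (the four conjuncts of the refuters' `NoSwirlDesign`, stated without importing it).
[cite: Palasek2026ElementaryModel, §3.3] -/
theorem schedule_axisym_noSwirl {c₃ r : ℝ} (hR : R.BoxNumerics c₃ r) {c₄ : ℝ} (hc₄ : 0 < c₄) (hc₄' : c₄ ≤ 1)
    (hU : IsAxisymmetric U) (hsw : HasNoSwirl U) :
    IsAxisymmetric (h.schedule hR c₄ hc₄ hc₄').u₀ ∧ HasNoSwirl (h.schedule hR c₄ hc₄ hc₄').u₀ ∧
      (∀ t, 0 ≤ t → IsAxisymmetric ((h.schedule hR c₄ hc₄ hc₄').f t)) ∧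
      ∀ t, 0 ≤ t → HasNoSwirl ((h.schedule hR c₄ hc₄ hc₄').f t) := by
  refine ⟨?_, ?_, fun t _ => ?_, fun t _ => ?_⟩
  · show IsAxisymmetric (0 : EuclideanSpace ℝ (Fin 3) → EuclideanSpace ℝ (Fin 3))
    exact isAxisymmetric_zero_field
  · show HasNoSwirl (0 : EuclideanSpace ℝ (Fin 3) → EuclideanSpace ℝ (Fin 3))
    exact hasNoSwirl_zero_field
  · rw [h.schedule_f hR hc₄ hc₄']
    exact isAxisymmetric_germForce hU _ _ t
  · rw [h.schedule_f hR hc₄ hc₄']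
    exact hasNoSwirl_germForce hU hsw _ _ t

end LevelZeroDataAt

namespace LineGermDataAt

variable {R : TowerRates} {U : EuclideanSpace ℝ (Fin 3) → EuclideanSpace ℝ (Fin 3)} {ρ σ₀ ε c₄ : ℝ}
  (d : LineGermDataAt R U ρ σ₀ ε c₄)
include d

/-- **The explicit germ schedule of an axisymmetric swirl-free profile is an axisymmetric swirl-free DESIGN**
(datum `0`, force `lineForce U σ₀ ε`). [cite: Palasek2026ElementaryModel, §3.3] -/
theorem schedule_axisym_noSwirl {c₃ r : ℝ} (hR : R.BoxNumerics c₃ r) (hU : IsAxisymmetric U) (hsw : HasNoSwirl U) :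
    IsAxisymmetric (d.schedule hR).u₀ ∧ HasNoSwirl (d.schedule hR).u₀ ∧
      (∀ t, 0 ≤ t → IsAxisymmetric ((d.schedule hR).f t)) ∧ ∀ t, 0 ≤ t → HasNoSwirl ((d.schedule hR).f t) := by
  have hf : (d.schedule hR).f = lineForce U σ₀ ε := (d.schedule_facts hR).2.2.2.2.2.1
  refine ⟨?_, ?_, fun t _ => ?_, fun t _ => ?_⟩
  · show IsAxisymmetric (0 : EuclideanSpace ℝ (Fin 3) → EuclideanSpace ℝ (Fin 3))
    exact isAxisymmetric_zero_field
  · show HasNoSwirl (0 : EuclideanSpace ℝ (Fin 3) → EuclideanSpace ℝ (Fin 3))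
    exact hasNoSwirl_zero_field
  · rw [hf]
    exact isAxisymmetric_lineForce hU σ₀ ε t
  · rw [hf]
    exact hasNoSwirl_lineForce hU hsw σ₀ ε t

end LineGermDataAt

end Summit.NavierStokesRegularity.FluidComputer.PalasekTowerClayBridge.Germ

end
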